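import Literature.NumberTheory.Automorphic.ArchKirillovODEGL2Complex
import Literature.NumberTheory.Automorphic.ArchKirillovBesselGL2Real
import HarnessLib

/-!
# The Kirillov function of an `SU(2)`-spherical Casimir eigenvector of `GL₂(K_∞)` along a complex
# place is a `K`-Bessel function (Jacquet–Langlands (1970), §6)

Topic `NumberTheory/Automorphic`; namespace `Literature.NumberTheory.Automorphic`. Theorems only (no
definition, no named fact, no instance). The COMPLEX-place companion of `ArchKirillovBesselGL2Real`,
assembling `ArchKirillovODEGL2Complex.kirillovODE_complex` (the differential equation along the
modulus direction `H = E₀₀ ⊗ c_w`), the moderate growth of `y ↦ ℓ(τ(exp yH) v)`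
(`ArchGardingAffineConjGrowth.exists_norm_apply_gardingAct_le` with `exp(yH) = 1 + (e^y - 1)H`) and the
decaying solutions of `WhittakerODEDecayingSolution`:

* `exists_apply_gardingAct_expGLC_eq_besselMode` — for `τ` acting by contractions, `ℓ` continuous for the
  `U(𝔤)`-seminorms with `ℓ(τ(E₀₁ ⊗ c) u) = θ₁ ℓ(u)`, `ℓ(τ(E₀₁ ⊗ ic) u) = θ₂ ℓ(u)`,
  `(θ₁ - iθ₂)(θ₁ + iθ₂) = -a²`, `a > 0` (`a = 4π` for `ψ_w = e^{2πi tr_{ℂ/ℝ}}`), and `v ∈ 𝒢` spherical for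
  `SU(2)_w` with central characters `μ₁, μ₂` and holomorphic Casimir eigenvalue
  `λ = (μ₁ - iμ₂)²/2 - 2ν² - 2`, there is `c ∈ ℂ` with

    `ℓ(τ(exp yH) v) = c · e^{(μ₁+1)y/2} · besselMode a ν (e^y)`   for all `y ∈ ℝ`,

  i.e. `ℓ(τ(diag(t, 1)_w) v) = 2c |t|^{μ₁/2} · |t| K_{iν}(a|t|)` for `t = e^y > 0` — Jacquet–Langlands
  (1970), §6: the Whittaker functions of `GL₂(ℂ)` along the torus are `|t|_ℂ^{1/2} K(4π|t|)`-functions;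
* `exists_apply_gardingAct_expGLC_eq_besselMode_and_mellin` — and its Mellin transform
  `∫₀^∞ ℓ(τ(exp((log u)H)) v) u^{S - 1/2} du/u = 2c a^{-(S + (μ₁+1)/2)} 2^{S + (μ₁+1)/2 - 2} Γ(½(S + (μ₁+1)/2 + iν)) Γ(½(S + (μ₁+1)/2 - iν))`
  for `re(S + (μ₁+1)/2) > |im ν|` (`integral_cpow_mul_besselMode`); with `S = 2s` and `|t|_ℂ = t²` this is
  the product of two `Γ_ℂ`-factors `Γ_ℂ(s + (μ₁+1)/4 ± iν/2)` up to an exponential, the `L`-factor of the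
  spherical principal series of `GL₂(ℂ)` (Jacquet–Langlands (1970), §6, Thm. 6.4 context).

## References

* H. Jacquet, R. P. Langlands, *Automorphic Forms on GL(2)*, LNM 114 (1970), §6 (PDF pp. 130–150 of
  the held retypeset copy). [JacquetLanglands1970]
* A. W. Knapp, *Representation Theory of Semisimple Groups*, Princeton 1986, Ch. VIII §3. [Knapp1986]
-/

noncomputable section

open MeasureTheory Measure NumberField NumberField.InfinitePlace NumberField.mixedEmbedding IsDedekindDomain Set Filter
open scoped MatrixGroups Topology Classical

namespace Literature.NumberTheory.Automorphic

variable {K : Type} [Field K] [NumberField K]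

-- as in `ArchGardingWhittaker`
set_option backward.isDefEq.respectTransparency false

section ComplexPlace

variable {hcpt : isCompact_glFiniteIntegralLevel 2 K}
  {E : Type*} [NormedAddCommGroup E] [NormedSpace ℂ E] [CompleteSpace E]
  {τ : ContRepresentation ℂ (AutomorphyDatum.gl 2 K hcpt).arch.carrier E}
  (hτ : τ.IsStronglyContinuous) (w : {w : InfinitePlace K // IsComplex w})

local notation "𝐜" => ((0, Pi.single w 1) : mixedSpace K)
local notation "𝐜I" => ((0, Pi.single w Complex.I) : mixedSpace K)
local notation "Hc" => Matrix.single (0 : Fin 2) (0 : Fin 2) ((0, Pi.single w 1) : mixedSpace K)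
local notation "D" => gardingEnd (hcpt := hcpt) (τ := τ) hτ
local notation "A[" y "]" => gardingAct (hcpt := hcpt) (τ := τ) hτ (expGL ((y : ℝ) • Hc))
local notation "Dh[" i "," j "]" => (gardingEnd (hcpt := hcpt) (τ := τ) hτ (Matrix.single (i : Fin 2) (j : Fin 2) ((0, Pi.single w 1) : mixedSpace K)) -
  Complex.I • gardingEnd (hcpt := hcpt) (τ := τ) hτ (Matrix.single (i : Fin 2) (j : Fin 2) ((0, Pi.single w Complex.I) : mixedSpace K)))

/-- **The Kirillov function of an `SU(2)`-spherical Casimir eigenvector along a complex place is a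
`K`-Bessel function** (Jacquet–Langlands (1970), §6). With the notation of the module docstring there is
`c ∈ ℂ` such that `ℓ(τ(exp yH) v) = c e^{(μ₁+1)y/2} besselMode a ν (e^y)` for all `y ∈ ℝ`: the function
satisfies `kirillovODE_complex`, i.e. the weight-zero real equation with `μ = μ₁ + 1` and
`θ² = (θ₁ - iθ₂)(θ₁ + iθ₂) = -a²`, grows at most exponentially in `y`, hence is the decaying solution
(`exists_eq_const_mul_exp_mul_besselMode_of_growth`). [cite: JacquetLanglands1970, §6] [cite: Knapp1986, Ch. VIII §3] -/
theorem exists_apply_gardingAct_expGLC_eq_besselMode (hτb : ∀ g, ‖(τ g : E →L[ℂ] E)‖ ≤ 1)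
    {ℓ : archGardingSpace hcpt τ →ₗ[ℂ] ℂ}
    (hℓ : ∃ (C : ℝ) (𝒮 : Finset (List (Matrix (Fin 2) (Fin 2) (mixedSpace K)))), 0 ≤ C ∧
      ∀ v : archGardingSpace hcpt τ, ‖ℓ v‖ ≤ C * ∑ w ∈ 𝒮, ‖archWordDerivE hcpt τ w v‖)
    {θ₁ θ₂ : ℂ} (hθ₁ : ∀ u : archGardingSpace hcpt τ, ℓ (D (Matrix.single 0 1 𝐜) u) = θ₁ * ℓ u)
    (hθ₂ : ∀ u : archGardingSpace hcpt τ, ℓ (D (Matrix.single 0 1 𝐜I) u) = θ₂ * ℓ u)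
    {a : ℝ} (ha : 0 < a) (hθa : (θ₁ - Complex.I * θ₂) * (θ₁ + Complex.I * θ₂) = -((a : ℂ) ^ 2))
    (μ₁ μ₂ lam ν : ℂ) (hlam : lam = (μ₁ - Complex.I * μ₂) ^ 2 / 2 - 2 * ν ^ 2 - 2) (v : archGardingSpace hcpt τ)
    (hS1 : D (Matrix.single 0 1 𝐜 - Matrix.single 1 0 𝐜) v = 0)
    (hS2 : D (Matrix.single 0 1 𝐜I + Matrix.single 1 0 𝐜I) v = 0)
    (hS3 : D (Matrix.single 0 0 𝐜I - Matrix.single 1 1 𝐜I) v = 0)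
    (hZ1 : D (Matrix.single 0 0 𝐜 + Matrix.single 1 1 𝐜) v = μ₁ • v)
    (hZ2 : D (Matrix.single 0 0 𝐜I + Matrix.single 1 1 𝐜I) v = μ₂ • v)
    (hC : ∑ i : Fin 2, ∑ j : Fin 2, Dh[i,j] (Dh[j,i] v) = lam • v) :
    ∃ c : ℂ, ∀ y : ℝ, ℓ (A[y] v) = c * (Real.exp y : ℂ) ^ ((μ₁ + 1) / 2) * besselMode a ν (Real.exp y) := by
  -- the differential equation, rewritten with `θ = ia`
  have hIa : (Complex.I * a) ^ 2 = -((a : ℂ) ^ 2) := by rw [mul_pow, Complex.I_sq]; ring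
  have hode : ∀ y : ℝ, 2 * ℓ (A[y] (D Hc (D Hc v))) - (2 * (μ₁ + 1) + 2) * ℓ (A[y] (D Hc v)) +
      (μ₁ ^ 2 + 2 * μ₁ - Complex.I * μ₁ * μ₂ - μ₂ ^ 2 / 2 - lam) * ℓ (A[y] v) +
        2 * (Complex.I * a) ^ 2 * (Real.exp y : ℂ) ^ 2 * ℓ (A[y] v) = 0 := fun y => by
    have h := kirillovODE_complex hτ w hθ₁ hθ₂ μ₁ μ₂ lam v hS1 hS2 hS3 hZ1 hZ2 hC y
    rw [hθa] at h
    rw [hIa]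
    linear_combination h
  -- derivatives
  have hf : ∀ y : ℝ, HasDerivAt (fun x : ℝ => ℓ (A[x] v)) (ℓ (A[y] (D Hc v))) y :=
    fun y => hasDerivAt_apply_gardingAct_expGLC hτ w hℓ v y
  have hf₁ : ∀ y : ℝ, HasDerivAt (fun x : ℝ => ℓ (A[x] (D Hc v))) (ℓ (A[y] (D Hc (D Hc v)))) y :=
    fun y => hasDerivAt_apply_gardingAct_expGLC hτ w hℓ (D Hc v) y
  -- growth: `|ℓ(τ(exp yH) v)| ≤ M e^{2N|y|}` (`exp(yH) = 1 + (e^y - 1)H`, `exists_norm_apply_gardingAct_le`)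
  obtain ⟨M, N, hM, hb⟩ := exists_norm_apply_gardingAct_le hτ hτb hℓ Hc v
  have hgrow' : ∀ y : ℝ, 0 ≤ y → ‖ℓ (A[y] v)‖ ≤ M * Real.exp (((2 * N : ℕ) : ℝ) * y) := fun y hy => by
    have h := hb (expGL (y • Hc)) (Real.exp (-y) - 1) (Real.exp y - 1) (coe_expGL_smul_hZeroC_inv w y)
      (coe_expGL_smul_hZeroC w y)
    have key : (1 + |Real.exp (-y) - 1|) * (1 + |Real.exp y - 1|) ≤ Real.exp |y| ^ 2 := by
      have h1 := one_add_abs_exp_sub_one_le (-y)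
      rw [abs_neg] at h1
      have h2 := one_add_abs_exp_sub_one_le y
      have h0 : 0 ≤ 1 + |Real.exp (-y) - 1| := by positivity
      nlinarith
    calc ‖ℓ (A[y] v)‖ ≤ ((1 + |Real.exp (-y) - 1|) * (1 + |Real.exp y - 1|)) ^ N * M := h
      _ ≤ (Real.exp |y| ^ 2) ^ N * M := by gcongr
      _ = M * Real.exp ((2 * N : ℕ) * y) := by rw [abs_of_nonneg hy, Real.exp_nat_mul, pow_mul, mul_comm]
  have hν : ν ^ 2 + 1 / 4 = (μ₁ ^ 2 + 2 * μ₁ - Complex.I * μ₁ * μ₂ - μ₂ ^ 2 / 2 - lam) / 2 - (μ₁ + 1) ^ 2 / 4 - (μ₁ + 1) / 2 := by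
    rw [hlam]
    have hI := Complex.I_sq
    linear_combination (μ₂ ^ 2 / 4) * hI
  exact exists_eq_const_mul_exp_mul_besselMode_of_growth (f := fun x : ℝ => ℓ (A[x] v))
    (f₁ := fun x : ℝ => ℓ (A[x] (D Hc v))) (f₂ := fun x : ℝ => ℓ (A[x] (D Hc (D Hc v)))) hf hf₁ ha hIa hode
    hgrow' ν hν

/-- **The spherical Kirillov function at a complex place and its Mellin transform** (continuation of
`exists_apply_gardingAct_expGLC_eq_besselMode`): for `re(S + (μ₁+1)/2) > |im ν|`,

  `∫₀^∞ ℓ(τ(exp((log u) H)) v) u^{S - 1/2} du/u = c · 2 a^{-(S + (μ₁+1)/2)} 2^{S + (μ₁+1)/2 - 2} Γ(½(S + (μ₁+1)/2 + iν)) Γ(½(S + (μ₁+1)/2 - iν))`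

(`integral_cpow_mul_besselMode`). With `S = 2s` (the modulus character of `ℂ` is `|t|_ℂ = t²`) the two
Gamma functions are `Γ(s + (μ₁+1)/4 ± iν/2)`, i.e. two `Γ_ℂ`-factors up to an exponential `A·B^s` —
the `L`-factor of the spherical principal series of `GL₂(ℂ)` (Jacquet–Langlands (1970), §6).
[cite: JacquetLanglands1970, §6] -/
theorem exists_apply_gardingAct_expGLC_eq_besselMode_and_mellin (hτb : ∀ g, ‖(τ g : E →L[ℂ] E)‖ ≤ 1)
    {ℓ : archGardingSpace hcpt τ →ₗ[ℂ] ℂ}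
    (hℓ : ∃ (C : ℝ) (𝒮 : Finset (List (Matrix (Fin 2) (Fin 2) (mixedSpace K)))), 0 ≤ C ∧
      ∀ v : archGardingSpace hcpt τ, ‖ℓ v‖ ≤ C * ∑ w ∈ 𝒮, ‖archWordDerivE hcpt τ w v‖)
    {θ₁ θ₂ : ℂ} (hθ₁ : ∀ u : archGardingSpace hcpt τ, ℓ (D (Matrix.single 0 1 𝐜) u) = θ₁ * ℓ u)
    (hθ₂ : ∀ u : archGardingSpace hcpt τ, ℓ (D (Matrix.single 0 1 𝐜I) u) = θ₂ * ℓ u)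
    {a : ℝ} (ha : 0 < a) (hθa : (θ₁ - Complex.I * θ₂) * (θ₁ + Complex.I * θ₂) = -((a : ℂ) ^ 2))
    (μ₁ μ₂ lam ν : ℂ) (hlam : lam = (μ₁ - Complex.I * μ₂) ^ 2 / 2 - 2 * ν ^ 2 - 2) (v : archGardingSpace hcpt τ)
    (hS1 : D (Matrix.single 0 1 𝐜 - Matrix.single 1 0 𝐜) v = 0)
    (hS2 : D (Matrix.single 0 1 𝐜I + Matrix.single 1 0 𝐜I) v = 0)
    (hS3 : D (Matrix.single 0 0 𝐜I - Matrix.single 1 1 𝐜I) v = 0)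
    (hZ1 : D (Matrix.single 0 0 𝐜 + Matrix.single 1 1 𝐜) v = μ₁ • v)
    (hZ2 : D (Matrix.single 0 0 𝐜I + Matrix.single 1 1 𝐜I) v = μ₂ • v)
    (hC : ∑ i : Fin 2, ∑ j : Fin 2, Dh[i,j] (Dh[j,i] v) = lam • v) :
    ∃ c : ℂ, (∀ y : ℝ, ℓ (A[y] v) = c * (Real.exp y : ℂ) ^ ((μ₁ + 1) / 2) * besselMode a ν (Real.exp y)) ∧
      ∀ S : ℂ, |ν.im| < (S + (μ₁ + 1) / 2).re →
        ∫ u in Ioi (0 : ℝ), ℓ (A[Real.log u] v) * (u : ℂ) ^ (S - 1 / 2 - 1) =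
          c * (2 * ((a : ℂ) ^ (-(S + (μ₁ + 1) / 2)) * ((2 : ℂ) ^ (S + (μ₁ + 1) / 2 - 2) *
            Complex.Gamma ((S + (μ₁ + 1) / 2 + Complex.I * ν) / 2) * Complex.Gamma ((S + (μ₁ + 1) / 2 - Complex.I * ν) / 2)))) := by
  obtain ⟨c, hc⟩ := exists_apply_gardingAct_expGLC_eq_besselMode hτ w hτb hℓ hθ₁ hθ₂ ha hθa μ₁ μ₂ lam ν hlam v
    hS1 hS2 hS3 hZ1 hZ2 hC
  refine ⟨c, hc, fun S hS => ?_⟩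
  rw [← integral_cpow_mul_besselMode ha hS, ← MeasureTheory.integral_const_mul]
  refine setIntegral_congr_fun measurableSet_Ioi fun u hu => ?_
  rw [hc (Real.log u), Real.exp_log hu]
  ring

end ComplexPlace

end Literature.NumberTheory.Automorphic
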